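import Summits.QuantumAdvantage.QuantumAdvantage.Theorems.CubicForrelationNearExactIsExactSixteenDigits
import Summits.QuantumAdvantage.QuantumAdvantage.Theorems.CubicForrelationNearExactIsExactSaturatedTilings
import Summits.QuantumAdvantage.QuantumAdvantage.Theorems.CubicForrelationNearExactIsExactAffineForm
import Summits.QuantumAdvantage.QuantumAdvantage.Theorems.CubicForrelationNearExactIsExactTenBalancedA

/-!
# Crux `CubicForrelation.NearExactIsExact` (stmt-QuantumAdvantage-14043) — the RESIDUAL split configuration on 16 bits is
  empty (the arithmetic heart of the `θ₁₆ ≤ 31/32` rung)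

Certificate seat `b2b-cforr-cert` (gen 3).  HONEST FRAMING: a theorem about cubic Boolean functions on 16 bits — a
finite-slice verdict toward the `θ_n` ladder, NOT summit progress.

For a cubic `g : 𝔽₂¹⁶ → 𝔽₂` write `W_g = 64u` and `d₀, d₁, d₂` for the Euclidean binary digits of `u` (degrees `≤ 1, 2, 4`,
`…SixteenDigits`).  The capacity analysis of the companion file `…SixteenSplitCapacity` shows that a cubic `g` whose Walsh
capacity `Σ|W_g|` exceeds `(31/32)·2²⁴` is bent or in the following RESIDUAL configuration: the parity `d₀` is a NON-CONSTANT
affine function and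
* off its support (`u` even): `u ≡ 4 (mod 8)` (`d₁ = 0`, `d₂ = 1`);
* on its support (`u` odd): `u ≡ ±3 (mod 8)` (`d₂ = ¬d₁`).
THEOREM `sx_residual_false`: no cubic `g` on 16 bits is in the residual configuration.

Proof (a coordinate-free version of the landed `no_caseA` of `Negative/NoCaseATwelve.lean`, one tiling level deeper).
1. FLIP: `d₀` is the affine character `(−1)^{b}(−1)^{c·x}` (`stub_affineForm`) with `c ≠ 0`; for a coordinate `i` with
   `c_i = 1` the translation `t = e_i` swaps the two halves: `u(x ⊕ t) ≢ u(x) (mod 2)`.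
2. STRUCTURE: `d₁ = d₀ ∧ α` with `α := D_t d₁` AFFINE (`stub_derivDegree`), because `d₁` vanishes off the support of `d₀`.
   Hence on every `4`-cube `E_I` the digit `d₁` is `1` on `0 (mod 4)` points (three character sums `∈ 16ℤ`), `d₀` is `1` on
   `0 (mod 8)` points, and the pointwise congruence `u ≡ 4 + d₀ − 2d₁ (mod 8)` gives `Σ_{E_I} u ≡ 0 (mod 8)`.
3. TILINGS (`…SaturatedTilings`): Poisson over `E_I` and the saturated-family congruence on the `12`-cube `E_{Iᶜ}` give
   `Σ_{E_I} u = 4·N₄(Iᶜ) + 8k`, so `N₄(Iᶜ)` — the number of tilings of `Iᶜ` by `4` disjoint cubic monomials of `g` — is EVEN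
   for every `4`-set `I`.  On the other hand Poisson over `E_{{i}} = {0, e_i}` and the congruence on the `15`-cube give
   `u(0) + u(e_i) ≡ N₅({i}ᶜ) (mod 2)`, and `u(0) + u(e_i)` is ODD by step 1; but `N₅({i}ᶜ) = Σ_{s₀ ∋ j} N₄({i}ᶜ ∖ supp s₀)`
   (pivot `j ≠ i`) is a sum of even numbers. Contradiction.

References: J. Ax (1964) / R. J. McEliece (1972) (Carlet 2021 §4.1); MacWilliams–Sloane Ch. 13–15 (Reed–Muller codes, Poisson
summation).  Everything below is proved from Mathlib and the tree; axioms are the standard three.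
-/

set_option linter.dupNamespace false -- D-0017: single-problem summit ⇒ `QuantumAdvantage.QuantumAdvantage` by design

noncomputable section

namespace Summit.QuantumAdvantage.QuantumAdvantage.Theorems.CubicForrelation.NearExactIsExact

open Finset
open Literature.Computability.QuantumComplexity
open Literature.Computability.QuantumComplexity.BuzetChailloux (bxor zeroVec)
open Literature.Computability.QuantumComplexity.DerivativeWalsh (W)
open Summit.QuantumAdvantage.QuantumAdvantage.Theorems.SignedExactCubicForrelationNotPrBPP (eq_of_signOf_eq)

section Residual

variable (g : (Fin (8 + 8) → Bool) → Bool) (u : (Fin (8 + 8) → Bool) → ℤ)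

/-! ### Step 1: the flip across the split -/

/-- Two Booleans with opposite sign readings are complementary. [folklore] -/
theorem sx_eq_not_of_signOf_eq_neg {p q : Bool} (h : signOf p = -signOf q) : p = !q := by
  revert h
  cases p <;> cases q <;> norm_num [signOf]

/-- **The flip.** If the level-6 parity of a cubic `g` on 16 bits takes both values, there is a coordinate vector `e_i`
across the split: `u(x ⊕ e_i)` is odd exactly when `u(x)` is even (the parity is an affine character `(−1)^b (−1)^{c·x}` with
`c ≠ 0`; take `i` with `c_i = 1`). [this work] -/
theorem sx_exists_flip (hg : IsDegLeFun 3 g) (hu : ∀ x, W (fun y => signOf (g y)) x = (2 : ℝ) ^ 6 * (u x : ℝ))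
    (hodd : ∃ x, Odd (u x)) (heven : ∃ x, ¬ Odd (u x)) :
    ∃ i : Fin (8 + 8), ∀ x, Odd (u (bxor x (fun j => decide (j = i)))) ↔ ¬ Odd (u x) := by
  obtain ⟨c, b, hc⟩ := stub_affineForm (8 + 8) (fun x => decide (Odd (u x))) (sx_digitZero g u hg hu)
  have hci : ∃ i, c i = true := by
    by_contra hnone
    push Not at hnone
    have hc0 : ∀ x, twist c x = 1 := fun x => by
      unfold twist
      exact prod_eq_one fun l _ => by simp [hnone l]
    obtain ⟨x₁, hx₁⟩ := hodd
    obtain ⟨x₂, hx₂⟩ := heven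
    have h1 := hc x₁
    have h2 := hc x₂
    rw [hc0, mul_one] at h1 h2
    have e := eq_of_signOf_eq (h1.trans h2.symm)
    rw [decide_eq_true hx₁, decide_eq_false hx₂] at e
    exact Bool.noConfusion e
  obtain ⟨i, hi⟩ := hci
  refine ⟨i, fun x => ?_⟩
  have ht : twist c (fun j => decide (j = i)) = -1 := by
    rw [twist_comm, tb_twist_single, hi]
    simp [signOf]
  have h := hc (bxor x (fun j => decide (j = i)))
  rw [BuzetChailloux.twist_bxor_right, ht, mul_neg_one, mul_neg, ← hc x] at h
  have e := sx_eq_not_of_signOf_eq_neg h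
  by_cases hP : Odd (u (bxor x fun j => decide (j = i))) <;> by_cases hQ : Odd (u x) <;> simp [hP, hQ] at e ⊢

/-! ### Step 2: the structure `d₁ = d₀ ∧ α` and counting on `4`-cubes -/

/-- In the residual configuration the second digit factors through the flip: `d₁(x) = d₀(x) ∧ (d₁(x) ⊕ d₁(x ⊕ t))`. -/
theorem sx_residual_digitOne_eq (t : Fin (8 + 8) → Bool)
    (hH : ∀ x, ¬ Odd (u x) → ¬ Odd (u x / 2) ∧ Odd (u x / 2 / 2))
    (hflip : ∀ x, Odd (u (bxor x t)) ↔ ¬ Odd (u x)) (x : Fin (8 + 8) → Bool) :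
    decide (Odd (u x / 2)) =
      (decide (Odd (u x)) && (decide (Odd (u x / 2)) ^^ decide (Odd (u (bxor x t) / 2)))) := by
  by_cases h0 : Odd (u x)
  · have h1 : ¬ Odd (u (bxor x t) / 2) := (hH _ (fun h => (hflip x).1 h h0)).1
    rw [decide_eq_true h0, decide_eq_false h1]
    cases decide (Odd (u x / 2)) <;> rfl
  · rw [decide_eq_false h0, decide_eq_false (hH x h0).1]
    rfl

/-- The indicator of a conjunction through signs: `[P ∧ Q] = (1 − (−1)^P − (−1)^Q + (−1)^{P ⊕ Q})/4`. [folklore] -/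
theorem sx_ite_and_eq_signs (P Q : Bool) :
    (if (P && Q) = true then (1 : ℝ) else 0) = (1 - signOf P - signOf Q + signOf (P ^^ Q)) / 4 := by
  cases P <;> cases Q <;> norm_num [signOf]

/-- **Conjunctions of two affine functions on a `4`-cube.** For `P, Q` of degree `≤ 1` on 16 bits and `|I| = 4`, the number
of points of the coordinate cube `E_I` with `P ∧ Q` is a multiple of `4` (it is `(16 − S_P − S_Q + S_{P⊕Q})/4` with the three
character sums in `16ℤ` by Ax with `d = 1`). [this work] -/
theorem sx_count_and_affine (P Q : (Fin (8 + 8) → Bool) → Bool) (hP : IsDegLeFun 1 P) (hQ : IsDegLeFun 1 Q)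
    (I : Finset (Fin (8 + 8))) (hI : #I = 4) :
    ∃ w : ℤ, (#{x : Fin (8 + 8) → Bool | (∀ i, x i = true → i ∈ I) ∧ (P x && Q x) = true} : ℤ) = 4 * w := by
  obtain ⟨z₁, hz₁⟩ := stub_axParity (8 + 8) 1 P I le_rfl hP
  obtain ⟨z₂, hz₂⟩ := stub_axParity (8 + 8) 1 Q I le_rfl hQ
  obtain ⟨z₃, hz₃⟩ := stub_axParity (8 + 8) 1 (fun x => P x ^^ Q x) I le_rfl (bb_isDegLeFun_bxor hP hQ)
  rw [hI, show (4 + 1 - 1) / 1 = 4 by norm_num] at hz₁ hz₂ hz₃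
  refine ⟨1 - z₁ - z₂ + z₃, ?_⟩
  have hcard : ((#{x : Fin (8 + 8) → Bool | (∀ i, x i = true → i ∈ I) ∧ (P x && Q x) = true} : ℤ) : ℝ) =
      ∑ x ∈ {x : Fin (8 + 8) → Bool | ∀ i, x i = true → i ∈ I}, (if (P x && Q x) = true then (1 : ℝ) else 0) := by
    rw [sum_boole, filter_filter]
    push_cast
    rfl
  have hE : ((#({x : Fin (8 + 8) → Bool | ∀ i, x i = true → i ∈ I} : Finset _) : ℕ) : ℝ) = 16 := by
    rw [bb_card_cube I, hI]
    norm_num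
  have key : ((#{x : Fin (8 + 8) → Bool | (∀ i, x i = true → i ∈ I) ∧ (P x && Q x) = true} : ℤ) : ℝ) =
      ((4 * (1 - z₁ - z₂ + z₃) : ℤ) : ℝ) := by
    rw [hcard, sum_congr rfl fun x _ => sx_ite_and_eq_signs (P x) (Q x), ← sum_div, sum_add_distrib, sum_sub_distrib,
      sum_sub_distrib, sum_const, nsmul_eq_mul, mul_one, hE, hz₁, hz₂, hz₃]
    push_cast
    ring
  exact_mod_cast key

/-! ### Step 3: cube sums of `u` in the residual configuration -/

/-- **Residual cube congruence.** In the residual configuration, for every `4`-set `I`: `Σ_{x ∈ E_I} u(x) ≡ 0 (mod 8)`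
(`u ≡ 4 + d₀ − 2d₁ (mod 8)` pointwise; `d₀` is `1` on `0 (mod 8)` points of `E_I`, `d₁ = d₀ ∧ α` on `0 (mod 4)` points).
[this work] -/
theorem sx_residual_cube_sum (hg : IsDegLeFun 3 g) (hu : ∀ x, W (fun y => signOf (g y)) x = (2 : ℝ) ^ 6 * (u x : ℝ))
    (t : Fin (8 + 8) → Bool) (hH : ∀ x, ¬ Odd (u x) → ¬ Odd (u x / 2) ∧ Odd (u x / 2 / 2))
    (hL : ∀ x, Odd (u x) → (Odd (u x / 2) ↔ ¬ Odd (u x / 2 / 2)))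
    (hflip : ∀ x, Odd (u (bxor x t)) ↔ ¬ Odd (u x)) (I : Finset (Fin (8 + 8))) (hI : #I = 4) :
    (8 : ℤ) ∣ ∑ x ∈ {x : Fin (8 + 8) → Bool | ∀ i, x i = true → i ∈ I}, u x := by
  -- pointwise: `u = 8q + 4 + [u odd] − 2·[⌊u/2⌋ odd]`
  have hpt : ∀ x, ∃ q : ℤ, u x = 8 * q + 4 + (if Odd (u x) then 1 else 0) - 2 * (if Odd (u x / 2) then 1 else 0) := by
    intro x
    obtain ⟨q, hq⟩ := td_mod_eight (u x)
    by_cases h0 : Odd (u x)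
    · have h12 := hL x h0
      refine ⟨q, ?_⟩
      rw [if_pos h0] at hq ⊢
      by_cases h1 : Odd (u x / 2)
      · rw [if_pos h1, if_neg (h12.1 h1)] at hq
        rw [if_pos h1]
        omega
      · rw [if_neg h1, if_pos (by simpa [h1] using h12)] at hq
        rw [if_neg h1]
        omega
    · obtain ⟨h1, h2⟩ := hH x h0
      refine ⟨q, ?_⟩
      rw [if_neg h0, if_neg h1, if_pos h2] at hq
      rw [if_neg h0, if_neg h1]
      omega
  choose q hq using hpt
  -- the two digit counts on the cube
  obtain ⟨z', hz'⟩ := td_count_cube (le_refl 1) (fun x => decide (Odd (u x))) (sx_digitZero g u hg hu) I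
  rw [hI, show (4 + 1 - 1) / 1 = 4 by norm_num] at hz'
  have hα : IsDegLeFun 1 (fun x => decide (Odd (u x / 2)) ^^ decide (Odd (u (bxor x t) / 2))) :=
    stub_derivDegree (8 + 8) 1 (fun x => decide (Odd (u x / 2))) t (sx_digitOne g u hg hu)
  obtain ⟨w, hw⟩ := sx_count_and_affine (fun x => decide (Odd (u x))) _ (sx_digitZero g u hg hu) hα I hI
  have hset : (univ.filter fun x : Fin (8 + 8) → Bool => (∀ i, x i = true → i ∈ I) ∧ Odd (u x / 2)) =
      univ.filter fun x : Fin (8 + 8) → Bool => (∀ i, x i = true → i ∈ I) ∧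
        (decide (Odd (u x)) && (decide (Odd (u x / 2)) ^^ decide (Odd (u (bxor x t) / 2)))) = true := by
    apply filter_congr
    intro x _
    rw [← sx_residual_digitOne_eq u t hH hflip x, decide_eq_true_iff]
  have hsum : ∑ x ∈ {x : Fin (8 + 8) → Bool | ∀ i, x i = true → i ∈ I}, u x =
      8 * ∑ x ∈ {x : Fin (8 + 8) → Bool | ∀ i, x i = true → i ∈ I}, q x + 4 * 2 ^ #I +
        #{x : Fin (8 + 8) → Bool | (∀ i, x i = true → i ∈ I) ∧ decide (Odd (u x)) = true} -
        2 * #{x : Fin (8 + 8) → Bool | (∀ i, x i = true → i ∈ I) ∧ Odd (u x / 2)} := by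
    have hEI : ((#({x : Fin (8 + 8) → Bool | ∀ i, x i = true → i ∈ I} : Finset _) : ℕ) : ℤ) = 2 ^ #I := by
      rw [bb_card_cube I]
      push_cast
      rfl
    rw [sum_congr rfl fun x _ => hq x, sum_sub_distrib, sum_add_distrib, sum_add_distrib, ← mul_sum, ← mul_sum,
      sum_const, nsmul_eq_mul, hEI, td_sum_ite_odd, td_sum_ite_odd, filter_filter, filter_filter]
    simp only [decide_eq_true_eq]
    ring
  rw [hset, hI] at hsum
  rw [hsum, hw]
  have e1 : (#{x : Fin (8 + 8) → Bool | (∀ i, x i = true → i ∈ I) ∧ decide (Odd (u x)) = true} : ℤ) = 8 - 8 * z' := by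
    linarith
  rw [e1]
  exact ⟨∑ x ∈ {x : Fin (8 + 8) → Bool | ∀ i, x i = true → i ∈ I}, q x + 8 + 1 - z' - w, by ring⟩

/-- The bias sum of `g` over a coordinate cube, through a representing polynomial (Ax's product form
`ax_signOf_polyPhase`). [folklore] -/
theorem sx_bias_poly (p : MvPolynomial (Fin (8 + 8)) (ZMod 2)) (hrep : ∀ x, g x = polyPhase p x)
    (K : Finset (Fin (8 + 8))) :
    ∑ y ∈ {x : Fin (8 + 8) → Bool | ∀ i, x i = true → i ∈ K}, signOf (g y) =
      ((∑ y ∈ {x : Fin (8 + 8) → Bool | ∀ i, x i = true → i ∈ K},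
        ∏ s ∈ p.support, (if (∀ j ∈ s.support, y j = true) then (-1 : ℤ) else 1) : ℤ) : ℝ) := by
  rw [Int.cast_sum]
  exact sum_congr rfl fun x _ => by rw [hrep x, ax_signOf_polyPhase]

/-! ### Step 4: tiling parities and the contradiction -/

/-- **`N₄` is even.** In the residual configuration, for every coordinate set `K` with `|Kᶜ| = 4` the number of sets of `4`
monomials of (a cubic polynomial representing) `g` whose supports tile `K` is even: Poisson over `E_{Kᶜ}` and the saturated
congruence on the `12`-cube `E_K` give `Σ_{E_{Kᶜ}} u = 4·N₄(K) + 8k`, and the left side is `≡ 0 (mod 8)`. [this work] -/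
theorem sx_residual_N4_even (hg : IsDegLeFun 3 g) (hu : ∀ x, W (fun y => signOf (g y)) x = (2 : ℝ) ^ 6 * (u x : ℝ))
    (p : MvPolynomial (Fin (8 + 8)) (ZMod 2)) (hp : p.totalDegree ≤ 3) (hrep : ∀ x, g x = polyPhase p x)
    (t : Fin (8 + 8) → Bool) (hH : ∀ x, ¬ Odd (u x) → ¬ Odd (u x / 2) ∧ Odd (u x / 2 / 2))
    (hL : ∀ x, Odd (u x) → (Odd (u x / 2) ↔ ¬ Odd (u x / 2 / 2)))
    (hflip : ∀ x, Odd (u (bxor x t)) ↔ ¬ Odd (u x)) (K : Finset (Fin (8 + 8))) (hK : #Kᶜ = 4) :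
    Even #{S ∈ p.support.powerset | #S = 4 ∧ (S.biUnion fun s => s.support) = K} := by
  have hK12 : #K = 3 * 4 := by
    have := card_compl K
    rw [Fintype.card_fin] at this
    omega
  -- Poisson over `E_{Kᶜ}` with Ax's representation of the bias on `E_K`
  have hP := bb_poisson (fun y => signOf (g y)) Kᶜ
  rw [sum_congr rfl fun x _ => hu x, ← mul_sum, compl_compl, hK, sx_bias_poly g p hrep K] at hP
  obtain ⟨k, hk⟩ := st_cube_bias_congr p hp K 4 hK12
  rw [hk] at hP
  have hZ : (2 : ℤ) ^ 6 * ∑ x ∈ {x : Fin (8 + 8) → Bool | ∀ i, x i = true → i ∈ Kᶜ}, u x =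
      2 ^ 4 * ((-2) ^ 4 * (#{S ∈ p.support.powerset | #S = 4 ∧ (S.biUnion fun s => s.support) = K} : ℕ) +
        2 ^ (4 + 1) * k) := by
    exact_mod_cast hP
  obtain ⟨r, hr⟩ := sx_residual_cube_sum g u hg hu t hH hL hflip Kᶜ hK
  rw [hr] at hZ
  norm_num at hZ
  have hEven : Even ((#{S ∈ p.support.powerset | #S = 4 ∧ (S.biUnion fun s => s.support) = K} : ℕ) : ℤ) :=
    ⟨r - k, by omega⟩
  exact (Int.even_coe_nat _).1 hEven

/-- The one-dimensional coordinate cube `E_{{i}}` is the pair `{0, e_i}`. [folklore] -/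
theorem sx_cube_singleton (i : Fin (8 + 8)) :
    ({x : Fin (8 + 8) → Bool | ∀ j, x j = true → j ∈ ({i} : Finset (Fin (8 + 8)))} : Finset _) =
      {zeroVec, fun j => decide (j = i)} := by
  ext x
  simp only [mem_filter, mem_univ, true_and, mem_singleton, mem_insert]
  constructor
  · intro h
    by_cases hxi : x i = true
    · right
      funext j
      by_cases hji : j = i
      · subst hji; simp [hxi]
      · have : x j = false := by
          cases hxj : x j
          · rfl
          · exact absurd (h j hxj) hji
        simp [hji, this]
    · left
      funext j
      cases hxj : x j
      · rfl
      · have hji := h j hxj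
        subst hji
        exact absurd hxj hxi
  · rintro (rfl | rfl) j hj
    · exact absurd hj (by simp [zeroVec])
    · simpa using hj

/-- **The residual configuration is empty.** No cubic `g : 𝔽₂¹⁶ → 𝔽₂` with `W_g = 64u` has a non-constant parity `[u odd]`
with `u ≡ 4 (mod 8)` off its support and `u ≡ ±3 (mod 8)` on it (in digits: `d₁ = 0, d₂ = 1` where `u` is even, `d₂ = ¬d₁`
where `u` is odd).  See the module docstring for the proof (flip, `d₁ = d₀ ∧ α`, tiling parities `N₄` even vs `N₅` odd).
[this work] -/
theorem sx_residual_false (hg : IsDegLeFun 3 g) (hu : ∀ x, W (fun y => signOf (g y)) x = (2 : ℝ) ^ 6 * (u x : ℝ))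
    (hodd : ∃ x, Odd (u x)) (heven : ∃ x, ¬ Odd (u x))
    (hH : ∀ x, ¬ Odd (u x) → ¬ Odd (u x / 2) ∧ Odd (u x / 2 / 2))
    (hL : ∀ x, Odd (u x) → (Odd (u x / 2) ↔ ¬ Odd (u x / 2 / 2))) : False := by
  obtain ⟨p, hp, hrep⟩ := id hg
  obtain ⟨i, hflip⟩ := sx_exists_flip g u hg hu hodd heven
  set t : Fin (8 + 8) → Bool := fun j => decide (j = i) with htdef
  set K : Finset (Fin (8 + 8)) := ({i} : Finset (Fin (8 + 8)))ᶜ with hKdef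
  have hK15 : #K = 3 * (4 + 1) := by rw [hKdef, card_compl, Fintype.card_fin, card_singleton]
  -- a pivot `j ≠ i`
  obtain ⟨j, hji⟩ : ∃ j : Fin (8 + 8), j ≠ i := by
    by_cases h0 : (0 : Fin (8 + 8)) = i
    · exact ⟨1, fun h => by rw [← h0] at h; exact absurd h (by decide)⟩
    · exact ⟨0, h0⟩
  have hjK : j ∈ K := by rw [hKdef, mem_compl, mem_singleton]; exact hji
  -- `N₅(K)` is even: every `N₄(K ∖ supp s₀)` is even
  have hN5even : Even #{S ∈ p.support.powerset | #S = 4 + 1 ∧ (S.biUnion fun s => s.support) = K} := by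
    refine st_even_saturated_succ p hp K j hjK 4 hK15 fun s₀ hs₀ _ hs₀K hs₀3 => ?_
    refine sx_residual_N4_even g u hg hu p hp hrep t hH hL hflip (K \ s₀.support) ?_
    have h1 : #(K \ s₀.support) = #K - #s₀.support := card_sdiff_of_subset hs₀K
    have h2 := card_compl (K \ s₀.support)
    rw [Fintype.card_fin] at h2
    omega
  -- `N₅(K)` is odd: Poisson over `E_{{i}} = {0, e_i}`, where `u(0) + u(e_i)` is odd
  have hP := bb_poisson (fun y => signOf (g y)) ({i} : Finset (Fin (8 + 8)))
  rw [sum_congr rfl fun x _ => hu x, ← mul_sum, card_singleton, ← hKdef, sx_bias_poly g p hrep K] at hP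
  obtain ⟨k₅, hk₅⟩ := st_cube_bias_congr p hp K (4 + 1) hK15
  rw [hk₅, sx_cube_singleton] at hP
  have hne : (zeroVec : Fin (8 + 8) → Bool) ≠ t := by
    intro h
    have := congrFun h i
    simp [zeroVec, htdef] at this
  rw [sum_pair hne] at hP
  have hZ : (2 : ℤ) ^ 6 * (u zeroVec + u t) =
      2 ^ 1 * ((-2) ^ (4 + 1) * (#{S ∈ p.support.powerset | #S = 4 + 1 ∧ (S.biUnion fun s => s.support) = K} : ℕ) +
        2 ^ (4 + 1 + 1) * k₅) := by
    exact_mod_cast hP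
  have hsumodd : Odd (u zeroVec + u t) := by
    have h0 := hflip zeroVec
    rw [BuzetChailloux.zeroVec_bxor] at h0
    rcases Int.even_or_odd (u zeroVec) with he | ho
    · exact Even.add_odd he (h0.2 (Int.not_odd_iff_even.2 he))
    · exact Odd.add_even ho (Int.not_odd_iff_even.1 (fun h => (h0.1 h) ho))
  obtain ⟨r, hr⟩ := hN5even
  rw [hr] at hZ
  obtain ⟨s, hs⟩ := hsumodd
  rw [hs] at hZ
  push_cast at hZ
  norm_num at hZ
  omega

end Residual

end Summit.QuantumAdvantage.QuantumAdvantage.Theorems.CubicForrelation.NearExactIsExact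

end
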